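import Summits.BirchSwinnertonDyer.BirchSwinnertonDyer.Theorems.ManinLocalTwoThreeTameThreeNeronScalarExists
import HarnessLib

/-!
# The discriminant of the Vélu `3`-quotient: `Δ(W/C) · D₀⁴ = Δ(W)³` (Dokchitser–Dokchitser 2015 Thm. 5 at `l = 3`, as an
# EXACT ring identity modulo `Ψ₃`), and the minimal discriminant of `W/C` at EVERY prime

Summit `BirchSwinnertonDyer`, route `ManinLocalTwoThree` (cell bsd-f2-manin), crux C3 `ManinPrimeToThreeAtNine`
(stmt-BirchSwinnertonDyer-22968); the an planner's support row S-an-41 `VeluDiscriminantValuationThree` (MEMO-an §67: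
«`v₃((c₄′³ − c₆′²)/1728) = 3δ − 4v₃D₀`; Lean-size S (ring identity mod Ψ)», census identity I3 114 988 / 0) — PROVED here as an
identity in any field of characteristic `0`, and read at every prime through the Néron-scaling dichotomy of
`…TameThreeNeronScalarExists` (p644330):

* `velu_three_Δ_mul_pow_four_eq` — for `3q⁴ − c₄q²/8 − c₆q/72 − c₄²/2304 = 0` (the `3`-division relation on the short model):
  `((1440q² − 9c₄)³ − (60480q³ − 756c₄q − 27c₆)²)/1728 · (4q³ − c₄q/12 − c₆/216)⁴ = ((c₄³ − c₆²)/1728)³`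
  (a 24-term certificate `Q` with `Δ^{Vélu}·D₀⁴ − Δ³ = Q·Ψ₃`, found by polynomial division, checked by `linear_combination`);
* `Ψ₂Sq_eval_sub_b₂_div_twelve_explicit` — covariance `Ψ₂²_W(q − b₂/12) = 4q³ − c₄q/12 − c₆/216` (so `D₀ = Ψ₂²` at the kernel);
* `velu_three_Δ_mul_Ψ₂Sq_pow_four` — curve form: `W.Ψ₃(q − b₂/12) = 0 ⟹ Δ(T)·Ψ₂²_W(q − b₂/12)⁴ = Δ(W)³` for every carrier `T`
  of the `u = 1` Vélu pair; hence `D₀ ≠ 0`, `Δ(T) ≠ 0` (`velu_three_Ψ₂Sq_ne_zero`, `velu_three_Δ_ne_zero`) and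
  `ord_p Δ(T) = 3·ord_p Δ(W) − 4·ord_p D₀` at every prime (`padicValRat_velu_three_Δ`);
* `exists_isGloballyMinimal_dvd_three_velu_three'` — p644330's dichotomy WITHOUT the nonsingularity hypothesis, together with
  THE MINIMAL DISCRIMINANT OF `W/C` AT EVERY PRIME: `ord_p Δ_min(W′) = 3·ord_p Δ_min(W) − 4·ord_p D₀ − 12·ord_p k`, `k ∣ 3`
  (so at `p ≠ 3` the `u = 1` Vélu pair is minimal-compatible: Dokchitser–Dokchitser Table 1, rows `l ≠ p`, for rational `3`-kernels;
  at `p = 3`: MEMO-an §67.2 (a) `δ′ = δ + K − 12·v₃(u)` with `K = 2δ − 4v₃D₀`).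

HONEST FRAMING: algebra and bookkeeping; C3, Manin's conjecture and BSD are not proved.  No definitions, no named facts, no sorry.
References: [DokchitserDokchitser2015LocalInvariants] Thm. 5 and Table 1; [SilvermanAEC2009] III.4.12 (Vélu), Exercise 3.7;
J. Vélu, C. R. Acad. Sci. Paris 273 (1971); HOME/MEMO-an.md §67 (S-an-41, census 114 988 / 0).
-/

set_option linter.dupNamespace false
set_option autoImplicit false

noncomputable section

open scoped Classical

open WeierstrassCurve IsDedekindDomain NumberField Rat.HeightOneSpectrum Polynomial
  Literature.NumberTheory.DiophantineGeometry Literature.NumberTheory.EllipticCurves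
  Literature.NumberTheory.EllipticCurves.ModularForms
  Summit.BirchSwinnertonDyer.Rank1Residual.Additive

namespace Summit.BirchSwinnertonDyer.BirchSwinnertonDyer.Theorems.ManinLocalTwoThree

/-! ### §1 The identity -/

/-- **Dokchitser–Dokchitser Thm. 5 at `l = 3`, exact form: `Δ^{Vélu}·D₀⁴ = Δ³` modulo the `3`-division relation** (short
model, `g₂ = c₄/12`, `g₃ = c₆/216`; `D₀ = 4q³ − g₂q − g₃`): a polynomial identity with an explicit 24-term multiplier of `Ψ₃`.
[cite: DokchitserDokchitser2015LocalInvariants, Thm. 5 (v(Δ') = 3v(Δ) − 4v(D₀) for a 3-isogeny)] -/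
theorem velu_three_Δ_mul_pow_four_eq {K : Type*} [Field K] [CharZero K] (c4 c6 q : K)
    (hΨ : 3 * q ^ 4 - c4 / 8 * q ^ 2 - c6 / 72 * q - c4 ^ 2 / 2304 = 0) :
    ((1440 * q ^ 2 - 9 * c4) ^ 3 - (60480 * q ^ 3 - 756 * c4 * q - 27 * c6) ^ 2) / 1728 *
        (4 * q ^ 3 - c4 / 12 * q - c6 / 216) ^ 4 = ((c4 ^ 3 - c6 ^ 2) / 1728) ^ 3 := by
  linear_combination ((1 / 2239488 : ℚ) * c4 ^ 7 + (-1 / 7776 : ℚ) * c4 ^ 6 * q ^ 2 + (-1 / 69984 : ℚ) * c4 ^ 5 * c6 * q + (451 / 5184 : ℚ) * c4 ^ 5 * q ^ 4 + (-1 / 746496 : ℚ) * c4 ^ 4 * c6 ^ 2 + (145 / 7776 : ℚ) * c4 ^ 4 * c6 * q ^ 3 + (-745 / 36 : ℚ) * c4 ^ 4 * q ^ 6 + (479 / 279936 : ℚ) * c4 ^ 3 * c6 ^ 2 * q ^ 2 + (-2567 / 648 : ℚ) * c4 ^ 3 * c6 * q ^ 5 + (6580 / 3 : ℚ) * c4 ^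 3 * q ^ 8 + (7 / 93312 : ℚ) * c4 ^ 2 * c6 ^ 3 * q + (-1493 / 5184 : ℚ) * c4 ^ 2 * c6 ^ 2 * q ^ 4 + (982 / 3 : ℚ) * c4 ^ 2 * c6 * q ^ 7 + (-117504 : ℚ) * c4 ^ 2 * q ^ 10 + (1 / 559872 : ℚ) * c4 * c6 ^ 4 + (-637 / 69984 : ℚ) * c4 * c6 ^ 3 * q ^ 3 + (881 / 54 : ℚ) * c4 * c6 ^ 2 * q ^ 6 + (-11936 : ℚ) * c4 * c6 * q ^ 9 + (3133440 : ℚ) * c4 * q ^ 12 + (-31 / 279936 : ℚ) * c6 ^ 4 * q ^ 2 + (65 / 243 : ℚ) * c6 ^ 3 * q ^ 5 + (-908 / 3 : ℚ) * c6 ^ 2 * q ^ 8 + (161280 : ℚ) * c6 * q ^ 11 + (-33177600 : ℚ) * q ^ 14) * hΨ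

/-- **Covariance of `Ψ₂²`** under completing the square and the cube (`u = 1`, `r = −b₂/12`): for any model `W/ℚ`,
`Ψ₂²_W(q − b₂/12) = 4q³ − (c₄/12)q − c₆/216` — a polynomial identity. [cite: SilvermanAEC2009, III.1 and Exercise 3.7] -/
theorem Ψ₂Sq_eval_sub_b₂_div_twelve_explicit (W : WeierstrassCurve ℚ) (q : ℚ) :
    W.Ψ₂Sq.eval (q - W.b₂ / 12) = 4 * q ^ 3 - W.c₄ / 12 * q - W.c₆ / 216 := by
  simp only [WeierstrassCurve.Ψ₂Sq, WeierstrassCurve.c₄, WeierstrassCurve.c₆, eval_add, eval_mul, eval_pow, eval_C, eval_X]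
  ring

/-- The `3`-division relation in `(c₄, c₆, q)` form from `W.Ψ₃(q − b₂/12) = 0`. [cite: SilvermanAEC2009, Exercise 3.7] -/
theorem shortPsi3_of_Ψ₃_eval_sub (W : WeierstrassCurve ℚ) (q : ℚ) (hq : W.Ψ₃.eval (q - W.b₂ / 12) = 0) :
    3 * q ^ 4 - W.c₄ / 8 * q ^ 2 - W.c₆ / 72 * q - W.c₄ ^ 2 / 2304 = 0 := by
  rw [Ψ₃_eval_sub_b₂_div_twelve] at hq
  simp only [WeierstrassCurve.Ψ₃, WeierstrassCurve.b₂, WeierstrassCurve.b₄, WeierstrassCurve.b₆, WeierstrassCurve.b₈,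
    eval_add, eval_mul, eval_pow, eval_C, eval_X, eval_ofNat] at hq
  linear_combination hq

/-! ### §2 Curve form and valuations -/

/-- **`Δ(T) · Ψ₂²_W(q − b₂/12)⁴ = Δ(W)³` for every carrier `T` of the `u = 1` Vélu pair of a rational `3`-line** (any `W/ℚ`).
[cite: DokchitserDokchitser2015LocalInvariants, Thm. 5] -/
theorem velu_three_Δ_mul_Ψ₂Sq_pow_four (W : WeierstrassCurve ℚ) (q : ℚ) (hq : W.Ψ₃.eval (q - W.b₂ / 12) = 0)
    (T : WeierstrassCurve ℚ) (h4 : T.c₄ = 1440 * q ^ 2 - 9 * W.c₄)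
    (h6 : T.c₆ = 60480 * q ^ 3 - 756 * W.c₄ * q - 27 * W.c₆) :
    T.Δ * (W.Ψ₂Sq.eval (q - W.b₂ / 12)) ^ 4 = W.Δ ^ 3 := by
  have hid := velu_three_Δ_mul_pow_four_eq W.c₄ W.c₆ q (shortPsi3_of_Ψ₃_eval_sub W q hq)
  have hT : T.Δ = ((1440 * q ^ 2 - 9 * W.c₄) ^ 3 - (60480 * q ^ 3 - 756 * W.c₄ * q - 27 * W.c₆) ^ 2) / 1728 := by
    have h := T.c_relation; rw [h4, h6] at h; linear_combination h / 1728
  have hW : W.Δ = (W.c₄ ^ 3 - W.c₆ ^ 2) / 1728 := by linear_combination W.c_relation / 1728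
  rw [hT, hW, Ψ₂Sq_eval_sub_b₂_div_twelve_explicit]
  exact hid

/-- `D₀ = Ψ₂²_W(q − b₂/12) ≠ 0` at a rational `3`-line of an elliptic `W` (else `Δ(W)³ = 0`). [folklore] -/
theorem velu_three_Ψ₂Sq_ne_zero (W : WeierstrassCurve ℚ) [W.IsElliptic] (q : ℚ) (hq : W.Ψ₃.eval (q - W.b₂ / 12) = 0) :
    W.Ψ₂Sq.eval (q - W.b₂ / 12) ≠ 0 := by
  intro h0
  set T : WeierstrassCurve ℚ := ⟨0, 0, 0, -(1440 * q ^ 2 - 9 * W.c₄) / 48,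
    -(60480 * q ^ 3 - 756 * W.c₄ * q - 27 * W.c₆) / 864⟩ with hT
  have h4 : T.c₄ = 1440 * q ^ 2 - 9 * W.c₄ := by
    simp only [hT, WeierstrassCurve.c₄, WeierstrassCurve.b₂, WeierstrassCurve.b₄]; ring
  have h6 : T.c₆ = 60480 * q ^ 3 - 756 * W.c₄ * q - 27 * W.c₆ := by
    simp only [hT, WeierstrassCurve.c₆, WeierstrassCurve.b₂, WeierstrassCurve.b₄, WeierstrassCurve.b₆]; ring
  have h := velu_three_Δ_mul_Ψ₂Sq_pow_four W q hq T h4 h6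
  rw [h0] at h
  have hΔ : W.Δ ≠ 0 := by rw [← WeierstrassCurve.coe_Δ']; exact W.Δ'.ne_zero
  exact pow_ne_zero 3 hΔ (by simpa using h.symm)

/-- **The Vélu pair of a rational `3`-line on an elliptic curve is nonsingular**: every carrier `T` has `Δ(T) ≠ 0`. [folklore] -/
theorem velu_three_Δ_ne_zero (W : WeierstrassCurve ℚ) [W.IsElliptic] (q : ℚ) (hq : W.Ψ₃.eval (q - W.b₂ / 12) = 0)
    (T : WeierstrassCurve ℚ) (h4 : T.c₄ = 1440 * q ^ 2 - 9 * W.c₄)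
    (h6 : T.c₆ = 60480 * q ^ 3 - 756 * W.c₄ * q - 27 * W.c₆) : T.Δ ≠ 0 := by
  intro h0
  have h := velu_three_Δ_mul_Ψ₂Sq_pow_four W q hq T h4 h6
  rw [h0, zero_mul] at h
  have hΔ : W.Δ ≠ 0 := by rw [← WeierstrassCurve.coe_Δ']; exact W.Δ'.ne_zero
  exact pow_ne_zero 3 hΔ h.symm

/-- **`ord_p Δ(T) = 3·ord_p Δ(W) − 4·ord_p D₀` at every prime** for every carrier `T` of the Vélu pair
(Dokchitser–Dokchitser Thm. 5, `l = 3`, valuation form). [cite: DokchitserDokchitser2015LocalInvariants, Thm. 5] -/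
theorem padicValRat_velu_three_Δ (p : ℕ) [Fact p.Prime] (W : WeierstrassCurve ℚ) [W.IsElliptic] (q : ℚ)
    (hq : W.Ψ₃.eval (q - W.b₂ / 12) = 0) (T : WeierstrassCurve ℚ) (h4 : T.c₄ = 1440 * q ^ 2 - 9 * W.c₄)
    (h6 : T.c₆ = 60480 * q ^ 3 - 756 * W.c₄ * q - 27 * W.c₆) :
    padicValRat p T.Δ + 4 * padicValRat p (W.Ψ₂Sq.eval (q - W.b₂ / 12)) = 3 * padicValRat p W.Δ := by
  have h := congrArg (padicValRat p) (velu_three_Δ_mul_Ψ₂Sq_pow_four W q hq T h4 h6)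
  rw [padicValRat.mul (velu_three_Δ_ne_zero W q hq T h4 h6) (pow_ne_zero _ (velu_three_Ψ₂Sq_ne_zero W q hq)),
    padicValRat.pow (W.Ψ₂Sq.eval (q - W.b₂ / 12)), padicValRat.pow W.Δ] at h
  push_cast at h
  linarith

/-! ### §3 The minimal discriminant of the `3`-quotient at every prime -/

/-- **The Néron-scaling dichotomy with its discriminant bookkeeping, at every prime.**  `W/ℚ` globally minimal (any reduction),
`q` the short-model abscissa of a rational `3`-line: there are a globally minimal `W'` and `k ∣ 3` with `k⁴c₄(W')`, `k⁶c₆(W')` =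
the Vélu pair, and at every prime `p`:
`ord_p Δ_min(W') + 4·ord_p D₀ + 12·ord_p k = 3·ord_p Δ_min(W)` (`D₀ = Ψ₂²_W(q − b₂/12)`).  At `p ≠ 3`, `ord_p k = 0`.
[cite: DokchitserDokchitser2015LocalInvariants, Thm. 5 and §4 Lemma 10–11] -/
theorem exists_isGloballyMinimal_dvd_three_velu_three' (W : WeierstrassCurve ℚ) [W.IsElliptic] [W.IsGloballyMinimal]
    (q : ℚ) (hq : W.Ψ₃.eval (q - W.b₂ / 12) = 0) :
    ∃ (W' : WeierstrassCurve ℚ) (k : ℤ) (_ : W'.IsElliptic) (_ : W'.IsGloballyMinimal), k ∣ 3 ∧ k ≠ 0 ∧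
      (k : ℚ) ^ 4 * W'.c₄ = 1440 * q ^ 2 - 9 * W.c₄ ∧
      (k : ℚ) ^ 6 * W'.c₆ = 60480 * q ^ 3 - 756 * W.c₄ * q - 27 * W.c₆ ∧
      ∀ (p : ℕ) [Fact p.Prime], (padicValInt p W'.minimalDiscriminantInt : ℤ) +
        4 * padicValRat p (W.Ψ₂Sq.eval (q - W.b₂ / 12)) + 12 * (padicValInt p k : ℤ) =
        3 * padicValInt p W.minimalDiscriminantInt := by
  -- nonsingularity of the pair, from the identity
  set T : WeierstrassCurve ℚ := ⟨0, 0, 0, -(1440 * q ^ 2 - 9 * W.c₄) / 48,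
    -(60480 * q ^ 3 - 756 * W.c₄ * q - 27 * W.c₆) / 864⟩ with hT
  have hT4 : T.c₄ = 1440 * q ^ 2 - 9 * W.c₄ := by
    simp only [hT, WeierstrassCurve.c₄, WeierstrassCurve.b₂, WeierstrassCurve.b₄]; ring
  have hT6 : T.c₆ = 60480 * q ^ 3 - 756 * W.c₄ * q - 27 * W.c₆ := by
    simp only [hT, WeierstrassCurve.c₆, WeierstrassCurve.b₂, WeierstrassCurve.b₄, WeierstrassCurve.b₆]; ring
  have hne : (1440 * q ^ 2 - 9 * W.c₄) ^ 3 ≠ (60480 * q ^ 3 - 756 * W.c₄ * q - 27 * W.c₆) ^ 2 := by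
    intro h
    apply velu_three_Δ_ne_zero W q hq T hT4 hT6
    have hrel := T.c_relation
    rw [hT4, hT6, h, sub_self] at hrel
    linear_combination hrel / 1728
  obtain ⟨W', k, hW'e, hW'm, hk3, h4, h6⟩ := exists_isGloballyMinimal_dvd_three_velu_three W q hq hne
  have hk0 : k ≠ 0 := by rintro rfl; norm_num at hk3
  refine ⟨W', k, hW'e, hW'm, hk3, hk0, h4, h6, fun p _ ↦ ?_⟩
  -- the rescaled model `(k⁻¹; 0,0,0) • W'` carries the Vélu pair
  have hkQ : (k : ℚ) ≠ 0 := by exact_mod_cast hk0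
  set C : VariableChange ℚ := ⟨Units.mk0 ((k : ℚ)⁻¹) (inv_ne_zero hkQ), 0, 0, 0⟩ with hC
  have hu : ((C.u⁻¹ : ℚˣ) : ℚ) = k := by rw [Units.val_inv_eq_inv_val, hC, Units.val_mk0, inv_inv]
  have hS4 : (C • W').c₄ = 1440 * q ^ 2 - 9 * W.c₄ := by rw [variableChange_c₄, hu, h4]
  have hS6 : (C • W').c₆ = 60480 * q ^ 3 - 756 * W.c₄ * q - 27 * W.c₆ := by rw [variableChange_c₆, hu, h6]
  have hSΔ : (C • W').Δ = (k : ℚ) ^ 12 * (W'.minimalDiscriminantInt : ℚ) := by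
    rw [variableChange_Δ, hu, cast_minimalDiscriminantInt]
  have hv := padicValRat_velu_three_Δ p W q hq (C • W') hS4 hS6
  have hm0 : (W'.minimalDiscriminantInt : ℚ) ≠ 0 := by exact_mod_cast minimalDiscriminantInt_ne_zero W'
  rw [hSΔ, padicValRat.mul (pow_ne_zero _ hkQ) hm0, padicValRat.pow (k : ℚ), ← cast_minimalDiscriminantInt W] at hv
  simp only [padicValRat.of_int] at hv
  push_cast at hv
  linarith

end Summit.BirchSwinnertonDyer.BirchSwinnertonDyer.Theorems.ManinLocalTwoThree

end
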